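import Literature.MathematicalPhysics.QuantumLattice.DWaveSourceLeeYang
import Literature.MathematicalPhysics.QuantumLattice.DWaveSourceFreePressure
import Mathlib.Analysis.SpecialFunctions.Trigonometric.DerivHyp
import HarnessLib

/-!
# The Lee–Yang theorem for the free `d`-wave-sourced torus: all complex-source zeros are purely imaginary

Topic `Literature/MathematicalPhysics/QuantumLattice` (companion of `DWaveSourceFreePressure.lean` — the
BdG product formula of the free sourced partition function at REAL source — and of
`DWaveSourceLeeYang.lean` — the Lee–Yang-cone transfer).

**Theorem** (`re_eq_zero_of_partitionFn_dWaveSource_free_eq_zero`). For `U = 0`, `L ≥ 3`, `β ≠ 0`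
and every chemical potential `μ`, every zero `h ∈ ℂ` of the complex-sourced partition function
`Z_L(h) = tr exp(-β(hubbardTorusWith 2 L 1 0 μ - h(Δ_d + Δ_d†)))` is purely imaginary: `Re h = 0`.

Proof: both sides of the BdG product formula
`Z_L(s) = 2^{2L²} Π_k e^{-βξ_k}(1 + cosh(β√(ξ_k² + 8s²ĝ_d(k)²)))/2` (tree,
`partitionFn_dWaveSourceTorus_zero`, real `s`) extend to ENTIRE functions of the source — the left
side by `differentiable_partitionFn_sub_smul`, the right side because `cosh(β√w)` is an entire
function of `w` (the square-root lift `Literature.Analysis.Complex.exists_differentiable_comp_sq` of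
the even entire function `z ↦ cosh βz`) — so they agree on `ℂ` by the identity theorem
(`AnalyticOnNhd.eq_of_frequently_eq`). A zero forces `cosh(β√w_k) = -1` for some mode, i.e.
`e^{β√w_k} = -1`, `β√w_k ∈ iπ(2ℤ+1)`, so `w_k = ξ_k² + 8h²ĝ_d(k)² < 0` is real negative, whence `h² < 0`.

**Corollary** (`dWaveSource_free_sourcedGain_le_half_sq_mul_susceptibility`): the cone condition of
`dWaveSource_sourcedGain_le_of_zeros_in_cone` holds at `U = 0` with `κ = 1`, so for the FREE sourced
torus the full non-linear pressure gain is dominated by the zero-source `d`-wave pair susceptibility,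
`p̃_L(s) - p̃_L(0) ≤ s² χ_L/2` for ALL real `s` (GHS/Newman concavity in `s²`; an independent route to
the free half of the `TwSourcedInertness` reduction, cf. `DWaveSourceFreeGainBound.lean`).

## References

* T. D. Lee, C. N. Yang, Phys. Rev. 87 (1952) 410; C. M. Newman, Comm. Math. Phys. 41 (1975) 1.
* J. von Delft, D. C. Ralph, Phys. Rep. 345 (2001) 61, §4.2 (BdG partition function).
-/

noncomputable section

open scoped Matrix.Norms.L2Operator ComplexOrder
open Matrix Finset Filter Literature.Probability.LatticeModels
open _root_.Topology

namespace Literature.MathematicalPhysics.QuantumLattice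

variable (L : ℕ) [NeZero L]

/-! ### `cosh(β√w)` is an entire function of `w` -/

/-- The even entire function `z ↦ cosh(βz)` is `C(z²)` for an entire `C` with
`C w = cosh(β w^{1/2})`. [folklore] -/
theorem exists_coshSqrt (β : ℝ) :
    ∃ C : ℂ → ℂ, Differentiable ℂ C ∧ (∀ z : ℂ, C (z ^ 2) = Complex.cosh ((β : ℂ) * z)) ∧
      ∀ w : ℂ, C w = Complex.cosh ((β : ℂ) * w ^ (2⁻¹ : ℂ)) := by
  have hd : Differentiable ℂ fun z : ℂ => Complex.cosh ((β : ℂ) * z) :=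
    Complex.differentiable_cosh.comp (differentiable_id.const_mul _)
  have he : ∀ z : ℂ, Complex.cosh ((β : ℂ) * -z) = Complex.cosh ((β : ℂ) * z) := fun z => by
    rw [mul_neg, Complex.cosh_neg]
  obtain ⟨C, hC, hCsq, hCdef⟩ := Literature.Analysis.Complex.exists_differentiable_comp_sq hd he
  exact ⟨C, hC, hCsq, hCdef⟩

/-- `cosh x = -1` forces `x² ∈ (-∞, 0)`: indeed `e^x = -1`, so `x = (2n+1)πi`. [folklore] -/
theorem sq_re_neg_of_cosh_eq_neg_one {x : ℂ} (hx : Complex.cosh x = -1) :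
    (x ^ 2).im = 0 ∧ (x ^ 2).re < 0 := by
  -- `2 cosh x = e^x + e^{-x} = -2` ⇒ `(e^x + 1)² = 0`
  have h2 : Complex.exp x + Complex.exp (-x) = -2 := by
    rw [← Complex.two_cosh, hx]; norm_num
  have hexp : Complex.exp x = -1 := by
    have hne : Complex.exp x ≠ 0 := Complex.exp_ne_zero x
    have hinv : Complex.exp (-x) = (Complex.exp x)⁻¹ := Complex.exp_neg x
    rw [hinv] at h2
    have h3 : (Complex.exp x + 1) ^ 2 = 0 := by
      field_simp at h2
      linear_combination h2
    have h4 : Complex.exp x + 1 = 0 := pow_eq_zero_iff (n := 2) two_ne_zero |>.1 h3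
    linear_combination h4
  -- `e^{x - πi} = 1` ⇒ `x = πi + 2πi n`
  have h5 : Complex.exp (x - Real.pi * Complex.I) = 1 := by
    rw [Complex.exp_sub, hexp, Complex.exp_pi_mul_I]; norm_num
  obtain ⟨n, hn⟩ := Complex.exp_eq_one_iff.1 h5
  set r : ℝ := (2 * n + 1) * Real.pi with hr
  have hxeq : x = (r : ℂ) * Complex.I := by
    have : x = n * (2 * Real.pi * Complex.I) + Real.pi * Complex.I := by
      rw [← hn]; ring
    rw [this, hr]; push_cast; ring
  have hx2 : x ^ 2 = ((-(r ^ 2) : ℝ) : ℂ) := by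
    rw [hxeq, mul_pow, Complex.I_sq]; push_cast; ring
  rw [hx2, Complex.ofReal_im, Complex.ofReal_re]
  refine ⟨rfl, ?_⟩
  have hodd : ((2 * n + 1 : ℤ) : ℝ) ≠ 0 := by
    have : (2 * n + 1 : ℤ) ≠ 0 := by omega
    exact_mod_cast this
  have hr0 : r ≠ 0 := by
    rw [hr]
    push_cast at hodd ⊢
    exact mul_ne_zero hodd Real.pi_ne_zero
  have : 0 < r ^ 2 := by positivity
  linarith

/-- If `h²` (times a non-zero real square) plus a real square is a negative real, then `Re h = 0`.
Precisely: `ξ, g, β` real, `β ≠ 0`, and `(β · w^{1/2})² ∈ (-∞,0)` for `w = ξ² + (c h g)²` with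
`c` real, force `c g ≠ 0` and `h.re = 0`. Packaged as used below. [folklore] -/
theorem re_eq_zero_of_mode_zero {β ξ c g : ℝ} (hβ : β ≠ 0) {h : ℂ}
    (hw : (((β : ℂ) * (((ξ : ℂ) ^ 2 + ((c : ℂ) * h * (g : ℂ)) ^ 2) ^ (2⁻¹ : ℂ))) ^ 2).im = 0 ∧
      (((β : ℂ) * (((ξ : ℂ) ^ 2 + ((c : ℂ) * h * (g : ℂ)) ^ 2) ^ (2⁻¹ : ℂ))) ^ 2).re < 0) :
    h.re = 0 := by
  set w : ℂ := (ξ : ℂ) ^ 2 + ((c : ℂ) * h * (g : ℂ)) ^ 2 with hwdef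
  have hsq : (w ^ (2⁻¹ : ℂ)) ^ 2 = w := by
    have h := Complex.cpow_nat_inv_pow w (n := 2) two_ne_zero
    rwa [Nat.cast_ofNat] at h
  have hw' : ((β : ℂ) * w ^ (2⁻¹ : ℂ)) ^ 2 = (β : ℂ) ^ 2 * w := by rw [mul_pow, hsq]
  rw [hw'] at hw
  obtain ⟨him, hre⟩ := hw
  -- `w` is real and negative
  have hβ2 : (0 : ℝ) < β ^ 2 := by positivity
  have hwim : w.im = 0 := by
    have : ((β : ℂ) ^ 2 * w).im = β ^ 2 * w.im := by
      simp [sq, Complex.mul_im, Complex.mul_re]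
    rw [this] at him
    exact (mul_eq_zero.1 him).resolve_left hβ2.ne'
  have hwre : w.re < 0 := by
    have : ((β : ℂ) ^ 2 * w).re = β ^ 2 * w.re := by
      simp [sq, Complex.mul_im, Complex.mul_re, hwim]
    rw [this] at hre
    nlinarith
  -- `w = ξ² + (c g)² h²`: real and imaginary parts
  set a := h.re with ha
  set b := h.im with hb
  have hwre' : w.re = ξ ^ 2 + (c * g) ^ 2 * (a ^ 2 - b ^ 2) := by
    rw [hwdef]; simp [sq, Complex.mul_re, Complex.mul_im, ha, hb]; ring
  have hwim' : w.im = (c * g) ^ 2 * (2 * a * b) := by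
    rw [hwdef]; simp [sq, Complex.mul_re, Complex.mul_im, ha, hb]; ring
  rw [hwim'] at hwim
  rw [hwre'] at hwre
  have hcg : (c * g) ^ 2 ≠ 0 := by
    intro h0; rw [h0] at hwre; nlinarith [sq_nonneg ξ]
  have hab : a * b = 0 := by
    have := (mul_eq_zero.1 hwim).resolve_left hcg
    linarith
  rcases mul_eq_zero.1 hab with h1 | h1
  · exact h1
  · -- `b = 0` would make `w.re = ξ² + (cg)² a² ≥ 0`
    exfalso
    rw [h1] at hwre
    nlinarith [sq_nonneg ξ, sq_nonneg (c * g * a)]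

/-! ### The complex-source partition function of the free sourced torus and its zeros -/

/-- **Lee–Yang for the free `d`-wave BdG torus.** At `U = 0` (`L ≥ 3`, `β ≠ 0`) every complex zero
`h` of `Z_L(h) = tr e^{-β(H - h(Δ_d + Δ_d†))}` is purely imaginary. [cite: LeeYang1952]
[cite: VondelftRalph2001, §4.2] -/
theorem re_eq_zero_of_partitionFn_dWaveSource_free_eq_zero (hL : 3 ≤ L) {β : ℝ} (hβ : β ≠ 0)
    (μ : ℝ) {h : ℂ}
    (hz : partitionFn β (hubbardTorusWith 2 L 1 0 μ -
      h • (pairField dWaveFormFactor L + (pairField dWaveFormFactor L)ᴴ)) = 0) :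
    h.re = 0 := by
  obtain ⟨C, hC, hCsq, hCdef⟩ := exists_coshSqrt β
  -- the entire right-hand side of the BdG product formula
  set G : ℂ → ℂ := fun h => (2 : ℂ) ^ Fintype.card (Orb (FermionTorus 2 L)) *
    ∏ k : TorusSite 2 L, ((Real.exp (-(β * (torusBand L k - μ))) : ℂ) *
      ((1 + C ((torusBand L k - μ : ℂ) ^ 2 +
        ((2 * Real.sqrt 2 : ℂ) * h * (dWaveGap k : ℂ)) ^ 2)) / 2)) with hGdef
  set F : ℂ → ℂ := fun h => partitionFn β (hubbardTorusWith 2 L 1 0 μ -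
      h • (pairField dWaveFormFactor L + (pairField dWaveFormFactor L)ᴴ)) with hFdef
  have hFd : Differentiable ℂ F := differentiable_partitionFn_sub_smul β _ _
  have hGd : Differentiable ℂ G := by
    have hmode : ∀ k : TorusSite 2 L, Differentiable ℂ (fun h : ℂ =>
        ((Real.exp (-(β * (torusBand L k - μ))) : ℂ) *
          ((1 + C ((torusBand L k - μ : ℂ) ^ 2 +
            ((2 * Real.sqrt 2 : ℂ) * h * (dWaveGap k : ℂ)) ^ 2)) / 2))) := by
      intro k
      have hin : Differentiable ℂ (fun h : ℂ =>
          (torusBand L k - μ : ℂ) ^ 2 + ((2 * Real.sqrt 2 : ℂ) * h * (dWaveGap k : ℂ)) ^ 2) := by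
        fun_prop
      have hc : Differentiable ℂ (fun h : ℂ =>
          C ((torusBand L k - μ : ℂ) ^ 2 + ((2 * Real.sqrt 2 : ℂ) * h * (dWaveGap k : ℂ)) ^ 2)) :=
        hC.comp hin
      exact ((hc.const_add 1).div_const 2).const_mul _
    rw [hGdef]
    exact (Differentiable.fun_finsetProd (u := Finset.univ) fun k _ => hmode k).const_mul _
  -- agreement on the real axis
  have hagree : ∀ s : ℝ, F s = G s := by
    intro s
    rw [hFdef, hGdef]
    simp only
    have e : hubbardTorusWith 2 L 1 0 μ -
        (s : ℂ) • (pairField dWaveFormFactor L + (pairField dWaveFormFactor L)ᴴ) =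
          dWaveSourceTorus L 0 μ s := rfl
    rw [e, partitionFn_dWaveSourceTorus_zero hL β μ s]
    congr 1
    push_cast
    refine Finset.prod_congr rfl fun k _ => ?_
    congr 2
    -- `C(ξ² + (2√2 s ĝ)²) = cosh(β √(ξ² + (2√2 s ĝ)²))`
    have hnn : 0 ≤ (torusBand L k - μ) ^ 2 + (2 * Real.sqrt 2 * s * dWaveGap k) ^ 2 := by positivity
    have hr : ((Real.sqrt ((torusBand L k - μ) ^ 2 + (2 * Real.sqrt 2 * s * dWaveGap k) ^ 2) : ℂ)) ^ 2 =
        (torusBand L k - μ : ℂ) ^ 2 + ((2 * Real.sqrt 2 : ℂ) * s * (dWaveGap k : ℂ)) ^ 2 := by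
      rw [← Complex.ofReal_pow, Real.sq_sqrt hnn]; push_cast; ring
    rw [← hr, hCsq]
  -- identity theorem: `F = G` on `ℂ`
  have hFG : F = G := by
    refine AnalyticOnNhd.eq_of_frequently_eq (z₀ := (0 : ℂ))
      (fun z _ => hFd.analyticAt z) (fun z _ => hGd.analyticAt z) ?_
    -- real points accumulate at `0` within `𝓝[≠] 0`
    have ht : Tendsto (fun t : ℝ => (t : ℂ)) (𝓝[≠] 0) (𝓝[≠] 0) := by
      refine tendsto_nhdsWithin_iff.2 ⟨?_, ?_⟩
      · exact (Complex.continuous_ofReal.tendsto' 0 0 (by simp)).mono_left nhdsWithin_le_nhds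
      · exact eventually_nhdsWithin_of_forall fun t ht => by
          simpa using ht
    refine ht.frequently ?_
    exact Filter.Eventually.frequently (Filter.Eventually.of_forall hagree)
  -- a zero of `F` is a zero of some mode factor `1 + C(w_k)`
  have hGz : G h = 0 := by rw [← hFG]; exact hz
  rw [hGdef] at hGz
  simp only at hGz
  rcases mul_eq_zero.1 hGz with h2 | hprod
  · exact absurd h2 (pow_ne_zero _ two_ne_zero)
  obtain ⟨k, _, hk⟩ := Finset.prod_eq_zero_iff.1 hprod
  rcases mul_eq_zero.1 hk with hexp | hk'
  · exact absurd hexp (by exact_mod_cast (Real.exp_pos _).ne')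
  have hC1 : C ((torusBand L k - μ : ℂ) ^ 2 + ((2 * Real.sqrt 2 : ℂ) * h * (dWaveGap k : ℂ)) ^ 2) = -1 := by
    have := div_eq_zero_iff.1 hk'
    rcases this with h1 | h2
    · linear_combination h1
    · norm_num at h2
  rw [hCdef] at hC1
  have hsq := sq_re_neg_of_cosh_eq_neg_one hC1
  have h2r : ((2 * Real.sqrt 2 : ℝ) : ℂ) = (2 * Real.sqrt 2 : ℂ) := by push_cast; ring
  refine re_eq_zero_of_mode_zero (ξ := torusBand L k - μ) (c := 2 * Real.sqrt 2) (g := dWaveGap k) hβ ?_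
  push_cast
  exact hsq

/-- **Free inertness from the free susceptibility, for ALL sources** (GHS/Newman concavity of the
free sourced pressure in `s²`): at `U = 0` (`L ≥ 3`, `β > 0`),
`p̃_L(s) - p̃_L(0) ≤ s²/2 · χ_L`, `χ_L = (β/L²)[(Q,Q)_Duh - ⟨Q⟩²]` the zero-source `d`-wave pair
susceptibility. [cite: Newman1975, Thm. 3] -/
theorem dWaveSource_free_sourcedGain_le_half_sq_mul_susceptibility (hL : 3 ≤ L) {β : ℝ}
    (hβ : 0 < β) (μ s : ℝ) :
    Real.log (partitionFn β (dWaveSourceTorus L 0 μ s)).re / (β * (L : ℝ) ^ 2) -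
        Real.log (partitionFn β (dWaveSourceTorus L 0 μ 0)).re / (β * (L : ℝ) ^ 2) ≤
      s ^ 2 / 2 * (β / (L : ℝ) ^ 2 *
        ((duhamel β (dWaveSourceTorus L 0 μ 0)
            (pairField dWaveFormFactor L + (pairField dWaveFormFactor L)ᴴ)
            (pairField dWaveFormFactor L + (pairField dWaveFormFactor L)ᴴ)).re -
          (gibbsState β (dWaveSourceTorus L 0 μ 0)
            (pairField dWaveFormFactor L + (pairField dWaveFormFactor L)ᴴ)).re ^ 2)) := by
  have h := dWaveSource_sourcedGain_le_of_zeros_in_cone L hβ 0 μ (κ := 1) one_pos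
    (fun h hz => by
      have hre := re_eq_zero_of_partitionFn_dWaveSource_free_eq_zero L hL hβ.ne' μ hz
      rw [hre]; norm_num) s
  simpa using h

end Literature.MathematicalPhysics.QuantumLattice
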